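import Summits.Ventures.PercRepro.RankLevelSetExplicitLin2KeyCube

/-!
# PercRepro — THE LEVEL-11 CUBE ROW OF C-025: THE KEY AT `p = 6 833` AND THE CONDITIONAL LEVEL STEP (p9, S4)

`proofs/SUBCLAIM-S4-p9.md` §S4.2⁗‴. The saturated row of record at level `11` is `p ≥ 18 780` (RankLevelSetExplicitLin2RowEleven).
With p4's cube multiplicity the assembled inequality `(P_d)` holds, exactly evaluated, at EVERY core corank `12 ≤ d ≤ 2059`
from `p = 6 833` — and fails at `p = 6 832` (corank `1 268`, the big class's saturation corank):
the cube key `KeyC 11 6833 d` (RankLevelSetExplicitLin2KeyCube) is checked by the kernel at the 2 048 coranks (`decide`, 1 chunk of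
2 048), and `c025_level_succ_of_keyC_row` turns the row into the level step
**`c025_eleven_cube_step (hprev : ∀ M p, 6 832 ≤ p → RLS M p 10) : ∀ M p, 6 833 ≤ p → RLS M p 11`** (`N₁(11) = 4 386`,
tail `4 156`). The unconditional rows are composed in RankLevelSetExplicitLin2CubeFloor. Axioms: standard.
-/

open scoped Matroid

namespace PercRepro

namespace ThmN

namespace Explicit

/-- **THE CUBE KEY ROW AT `(q, p) = (11, 6 833)`**: `KeyC 11 6833 d` at every corank `12 ≤ d ≤ 2059`, by the kernel. -/
theorem key_eleven_cube_row : ∀ t < 2048, KeyC 11 6833 (12 + t) := by decide +kernel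

/-- **THE CUBE FLOOR IS EXACT**: the cube key FAILS at `p = 6 832`, corank `1 268` (the big class's saturation corank), by the kernel. -/
theorem key_eleven_cube_sharp : ¬ KeyC 11 6832 1268 := by decide +kernel

end Explicit

variable {α : Type}

/-- **THE LEVEL-11 CUBE STEP FROM `6 833`**: level `11` for every finite matroid and every `p ≥ 6 833` from level `10` for
every `p ≥ 6 832` — the cube key row at `6 833`, its monotonicity in `p`, and the wrapper `c025_level_succ_of_keyC_row`
(`N₁(11) = 4 386 ≤ 6 833`, tail `4 156 ≤ 6 833`). -/
theorem c025_eleven_cube_step (hprev : ∀ (M : Matroid α) [M.Finite] (p : ℕ), 6832 ≤ p → RLS M p 10) :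
    ∀ (M : Matroid α) [M.Finite] (p : ℕ), 6833 ≤ p → RLS M p 11 :=
  c025_level_succ_of_keyC_row 10 (by norm_num) 6833 (by norm_num) (by norm_num) Explicit.key_eleven_cube_row hprev

end ThmN

end PercRepro
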